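import Mathlib.LinearAlgebra.Matrix.NonsingularInverse
import Mathlib.LinearAlgebra.Matrix.Nondegenerate
import Mathlib.LinearAlgebra.Matrix.GeneralLinearGroup.Defs
import Mathlib.LinearAlgebra.Matrix.Action
import Mathlib.LinearAlgebra.Projectivization.Action
import Mathlib.FieldTheory.IsAlgClosed.Basic
import Mathlib.FieldTheory.Minpoly.Field
import Literature.AlgebraicGeometry.ProjectiveSpace.CrossRatioProjectiveLine
import HarnessLib

/-!
# A projectivity of the line taking three rational points to rational points is rational;
# rational fibres of a rational function over an algebraically closed subfield

Topic `Literature/AlgebraicGeometry/ProjectiveSpace`, namespace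
`Literature.AlgebraicGeometry.ProjectiveSpace`. Theorems only (no definition, no instance, no
notation, no named fact); Mathlib + the sibling `CrossRatioProjectiveLine.lean` (Bamberg–Penttila
Lemma 4.6 `exists_projectivity_three_points`, Corollary 4.8 (von Staudt)
`projectivity_three_points_unique`).

## What is here

Let `ι : k →+* K` be a homomorphism of fields (an extension of scalars; `ι` is injective) and write
`ι ∘ X` for the base change of a vector `X : Fin 2 → k`; a point of `PG(1, K)` is **`k`-rational**
when it is represented by such a vector. As in the sibling file, "the points `P, Q` are distinct"
is `[P, Q] = P₀Q₁ − P₁Q₀ ≠ 0`, and a projectivity `g : Matrix (Fin 2) (Fin 2) K` takes the point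
`X` to the point `Y` iff `g *ᵥ X = e • Y`.

* §1 **Field of definition from three points** (`exists_eq_smul_map_of_three_points`): if `g` over
  `K` takes three pairwise distinct `k`-rational points `P, Q, R` to `k`-rational points
  `P', Q', R'` (pairwise distinct), then `g = l • g₀.map ι` for a scalar `l : K` and an invertible
  `g₀` over `k` — i.e. the class of `g` in `PGL(2, K)` lies in `PGL(2, k)`. Proof: Lemma 4.6 over
  `k` gives a `k`-projectivity `g₀` with `P, Q, R ↦ P', Q', R'`; its base change does the same
  over `K`; von Staudt's uniqueness over `K` makes `g` proportional to it. Hence: `l ≠ 0` when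
  `det g ≠ 0` (`exists_eq_smul_map_of_three_points_of_det_ne_zero`); `g` carries EVERY `k`-rational
  point to a `k`-rational point (`exists_mulVec_comp_eq_smul_comp`) and, when invertible, every
  `k`-rational point is the image of one (`exists_comp_mulVec_eq_smul`); the same in the language of
  Mathlib's `Projectivization` with the action of `GL (Fin 2) K`
  (`smul_mk_rational_of_three_points`).
* §2 **Rational fibres** (`mem_range_algebraMap_of_aeval_eq_zero`,
  `mem_range_algebraMap_of_aeval_eq_mul`): for `k` algebraically closed and any field extension
  `K`, every root in `K` of a non-zero polynomial over `k` lies in `k`; hence for polynomials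
  `p ≠ a·q` over `k` every solution in `K` of `p(x) = a·q(x)` lies in `k` — the fibres of the
  rational function `p/q ∈ k(t)` of `ℙ¹` over the `k`-points `a` and `∞` consist of `k`-points.

## Why it is here (use)

These are the two textbook steps of the «tripod descent» completion of the one-sentence proof of
[MochizukiSemiAnbd2006, Thm 6.8 (iv)] via [MochizukiGalSect2005, Cor 2.8] recorded by the abc-iut
cell (GAP-LEDGER row G-L3t7g10-1, the `⇐` half of
`Literature.AnabelianGeometry.SemiGraphs.Thm68Sub.AlgebraicIffTripodBelyi`): after Belyi descent
writes a finite étale cover of the tripod `ℙ¹ ∖ {0,1,∞}` over `L̄` as `h ∘ M⁻¹` with `h ∈ ℚ̄(t)` and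
`M ∈ PGL₂(L̄)`, §1 (with `k = ℚ̄`, `K = L̄`, the three points `M⁻¹(0), M⁻¹(1), M⁻¹(∞) ∈ ℙ¹(ℚ̄)`
taken to `0, 1, ∞`) gives `M ∈ PGL₂(ℚ̄)`, and §2 gives `h⁻¹{0, 1, ∞} ⊂ ℙ¹(ℚ̄)`; so all cusps of the
cover are `ℚ̄`-points. The descent statement itself (Szamuely, *Galois Groups and Fundamental
Groups*, Thm 4.6.10; Köck, *Belyi's theorem revisited*, Thm (2.2)) is NOT here.

## What is NOT here

* The bundled `PGL(2, k) → PGL(2, K)` phrasing; `n + 2` points in general position in `PGⁿ`;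
  Belyi's theorem in either direction; anything about curves or covers.

## References
* [BambergPenttila2023] J. Bamberg, T. Penttila, *Analytic Projective Geometry*, Cambridge 2023,
  §4.2, Lemma 4.6 and Corollary 4.8 (von Staudt) — the two inputs, proved in the sibling file.
* [Szamuely2009] T. Szamuely, *Galois Groups and Fundamental Groups*, CUP 2009, Thm 4.6.10 /
  Thm 4.7.6 (context only: where §1–§2 are used).
* [MochizukiGalSect2005] S. Mochizuki, *Galois sections in absolute anabelian geometry*, Nagoya
  Math. J. 179 (2005), Cor 2.8, proof p. 11 (context only).
* [StacksProject] The Stacks Project, Tag 09GR (algebraically closed fields: every irreducible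
  polynomial is linear) — the input of §2, in Mathlib as `IsAlgClosed.degree_eq_one_of_irreducible`.
-/

open Matrix Polynomial

namespace Literature.AlgebraicGeometry.ProjectiveSpace

universe u v

section ThreePoints

variable {k : Type u} {K : Type v} [Field k] [Field K]

/-! ## §1 Field of definition of a projectivity from three rational points -/

/-- Base change of a bracket: `[ιX, ιY] = ι [X, Y]`. [folklore] -/
private theorem bracket₂_comp (ι : k →+* K) (X Y : Fin 2 → k) :
    (⇑ι ∘ X) 0 * (⇑ι ∘ Y) 1 - (⇑ι ∘ X) 1 * (⇑ι ∘ Y) 0 = ι (X 0 * Y 1 - X 1 * Y 0) := by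
  simp only [Function.comp_apply, map_sub, map_mul]

/-- Distinct `k`-points stay distinct after base change: `[X, Y] ≠ 0 → [ιX, ιY] ≠ 0`. [folklore] -/
private theorem bracket₂_comp_ne_zero (ι : k →+* K) {X Y : Fin 2 → k}
    (h : X 0 * Y 1 - X 1 * Y 0 ≠ 0) :
    (⇑ι ∘ X) 0 * (⇑ι ∘ Y) 1 - (⇑ι ∘ X) 1 * (⇑ι ∘ Y) 0 ≠ 0 := by
  rw [bracket₂_comp]
  exact (map_ne_zero ι).mpr h

/-- Base change commutes with `*ᵥ`: `(ι g₀)(ι X) = ι (g₀ X)`. [folklore] -/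
private theorem map_mulVec_comp (ι : k →+* K) (g₀ : Matrix (Fin 2) (Fin 2) k) (X : Fin 2 → k) :
    g₀.map ι *ᵥ (⇑ι ∘ X) = ⇑ι ∘ (g₀ *ᵥ X) := by
  funext i
  exact (RingHom.map_mulVec ι g₀ X i).symm

/-- Base change commutes with scalars: `ι (a X) = ι a · ι X`. [folklore] -/
private theorem comp_smul (ι : k →+* K) (a : k) (X : Fin 2 → k) :
    ⇑ι ∘ (a • X) = ι a • (⇑ι ∘ X) := by
  funext i
  simp only [Function.comp_apply, Pi.smul_apply, smul_eq_mul, map_mul]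

/-- A non-zero vector stays non-zero after base change. [folklore] -/
private theorem comp_ne_zero (ι : k →+* K) {X : Fin 2 → k} (hX : X ≠ 0) : ⇑ι ∘ X ≠ 0 := by
  intro h
  apply hX
  funext i
  have := congrFun h i
  simpa using this

/-- **A projectivity of `PG(1, K)` taking three pairwise distinct `k`-rational points to
`k`-rational points is defined over `k`**: if `g (ιP) = a ιP'`, `g (ιQ) = b ιQ'`, `g (ιR) = c ιR'`
with `P, Q, R` and `P', Q', R'` pairwise distinct points with coordinates in `k`, then
`g = l • ι(g₀)` for some `l : K` and some `g₀` over `k` with `det g₀ ≠ 0` (namely the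
`k`-projectivity of Lemma 4.6 taking `P, Q, R ↦ P', Q', R'`; von Staudt's uniqueness over `K`).
No hypothesis on `a, b, c` or `det g` is needed (`l = 0` is allowed).
[cite: BambergPenttila2023, §4.2 Corollary 4.8 (von Staudt) — consequence over a subfield] -/
theorem exists_eq_smul_map_of_three_points (ι : k →+* K) {P Q R P' Q' R' : Fin 2 → k}
    (hPQ : P 0 * Q 1 - P 1 * Q 0 ≠ 0) (hPR : P 0 * R 1 - P 1 * R 0 ≠ 0)
    (hQR : Q 0 * R 1 - Q 1 * R 0 ≠ 0) (hPQ' : P' 0 * Q' 1 - P' 1 * Q' 0 ≠ 0)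
    (hPR' : P' 0 * R' 1 - P' 1 * R' 0 ≠ 0) (hQR' : Q' 0 * R' 1 - Q' 1 * R' 0 ≠ 0)
    (g : Matrix (Fin 2) (Fin 2) K) {a b c : K}
    (hgP : g *ᵥ (⇑ι ∘ P) = a • (⇑ι ∘ P')) (hgQ : g *ᵥ (⇑ι ∘ Q) = b • (⇑ι ∘ Q'))
    (hgR : g *ᵥ (⇑ι ∘ R) = c • (⇑ι ∘ R')) :
    ∃ (l : K) (g₀ : Matrix (Fin 2) (Fin 2) k), g₀.det ≠ 0 ∧ g = l • g₀.map ι := by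
  obtain ⟨g₀, a₀, b₀, c₀, hdet, -, -, hc₀, h₀P, h₀Q, h₀R⟩ :=
    exists_projectivity_three_points hPQ hPR hQR hPQ' hPR' hQR'
  have mP : g₀.map ι *ᵥ (⇑ι ∘ P) = ι a₀ • (⇑ι ∘ P') := by rw [map_mulVec_comp, h₀P, comp_smul]
  have mQ : g₀.map ι *ᵥ (⇑ι ∘ Q) = ι b₀ • (⇑ι ∘ Q') := by rw [map_mulVec_comp, h₀Q, comp_smul]
  have mR : g₀.map ι *ᵥ (⇑ι ∘ R) = ι c₀ • (⇑ι ∘ R') := by rw [map_mulVec_comp, h₀R, comp_smul]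
  obtain ⟨l, hl⟩ := projectivity_three_points_unique (bracket₂_comp_ne_zero ι hPQ')
    (bracket₂_comp_ne_zero ι hPR') (bracket₂_comp_ne_zero ι hQR') (bracket₂_comp_ne_zero ι hPQ)
    (g₀.map ι) g mP mQ mR hgP hgQ hgR ((map_ne_zero ι).mpr hc₀)
  exact ⟨l, g₀, hdet, hl⟩

/-- The invertible case: if moreover `det g ≠ 0` then `g = l • ι(g₀)` with `l ≠ 0` and `det g₀ ≠ 0`,
i.e. the class of `g` in `PGL(2, K)` is the class of a `k`-projectivity.
[cite: BambergPenttila2023, §4.2 Corollary 4.8 (von Staudt) — consequence over a subfield] -/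
theorem exists_eq_smul_map_of_three_points_of_det_ne_zero (ι : k →+* K)
    {P Q R P' Q' R' : Fin 2 → k}
    (hPQ : P 0 * Q 1 - P 1 * Q 0 ≠ 0) (hPR : P 0 * R 1 - P 1 * R 0 ≠ 0)
    (hQR : Q 0 * R 1 - Q 1 * R 0 ≠ 0) (hPQ' : P' 0 * Q' 1 - P' 1 * Q' 0 ≠ 0)
    (hPR' : P' 0 * R' 1 - P' 1 * R' 0 ≠ 0) (hQR' : Q' 0 * R' 1 - Q' 1 * R' 0 ≠ 0)
    (g : Matrix (Fin 2) (Fin 2) K) {a b c : K}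
    (hgP : g *ᵥ (⇑ι ∘ P) = a • (⇑ι ∘ P')) (hgQ : g *ᵥ (⇑ι ∘ Q) = b • (⇑ι ∘ Q'))
    (hgR : g *ᵥ (⇑ι ∘ R) = c • (⇑ι ∘ R')) (hg : g.det ≠ 0) :
    ∃ (l : K) (g₀ : Matrix (Fin 2) (Fin 2) k), l ≠ 0 ∧ g₀.det ≠ 0 ∧ g = l • g₀.map ι := by
  obtain ⟨l, g₀, hdet, rfl⟩ :=
    exists_eq_smul_map_of_three_points ι hPQ hPR hQR hPQ' hPR' hQR' g hgP hgQ hgR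
  refine ⟨l, g₀, ?_, hdet, rfl⟩
  rintro rfl
  apply hg
  rw [zero_smul, det_zero]

/-- **Such a projectivity takes every `k`-rational point to a `k`-rational point**: with `g`,
`P, Q, R`, `P', Q', R'` as in `exists_eq_smul_map_of_three_points`, for every `X` with coordinates
in `k` one has `g (ιX) = e • ιY` for some `Y` with coordinates in `k`, and `Y ≠ 0` if `X ≠ 0`
(so `ιY` represents a point).
[cite: BambergPenttila2023, §4.2 Corollary 4.8 (von Staudt) — consequence over a subfield] -/
theorem exists_mulVec_comp_eq_smul_comp (ι : k →+* K) {P Q R P' Q' R' : Fin 2 → k}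
    (hPQ : P 0 * Q 1 - P 1 * Q 0 ≠ 0) (hPR : P 0 * R 1 - P 1 * R 0 ≠ 0)
    (hQR : Q 0 * R 1 - Q 1 * R 0 ≠ 0) (hPQ' : P' 0 * Q' 1 - P' 1 * Q' 0 ≠ 0)
    (hPR' : P' 0 * R' 1 - P' 1 * R' 0 ≠ 0) (hQR' : Q' 0 * R' 1 - Q' 1 * R' 0 ≠ 0)
    (g : Matrix (Fin 2) (Fin 2) K) {a b c : K}
    (hgP : g *ᵥ (⇑ι ∘ P) = a • (⇑ι ∘ P')) (hgQ : g *ᵥ (⇑ι ∘ Q) = b • (⇑ι ∘ Q'))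
    (hgR : g *ᵥ (⇑ι ∘ R) = c • (⇑ι ∘ R')) (X : Fin 2 → k) :
    ∃ (e : K) (Y : Fin 2 → k), g *ᵥ (⇑ι ∘ X) = e • (⇑ι ∘ Y) ∧ (X ≠ 0 → Y ≠ 0) := by
  obtain ⟨l, g₀, hdet, rfl⟩ :=
    exists_eq_smul_map_of_three_points ι hPQ hPR hQR hPQ' hPR' hQR' g hgP hgQ hgR
  refine ⟨l, g₀ *ᵥ X, ?_, fun hX hY => hX (eq_zero_of_mulVec_eq_zero hdet hY)⟩
  rw [smul_mulVec, map_mulVec_comp]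

/-- **… and, when invertible, hits every `k`-rational point from a `k`-rational point**: with `g`
invertible as in `exists_eq_smul_map_of_three_points_of_det_ne_zero`, every `Y` with coordinates in
`k` is `g (ιX) = e • ιY` for some `X` with coordinates in `k` and some `e ≠ 0`, with `X ≠ 0` if
`Y ≠ 0`.
[cite: BambergPenttila2023, §4.2 Corollary 4.8 (von Staudt) — consequence over a subfield] -/
theorem exists_comp_mulVec_eq_smul (ι : k →+* K) {P Q R P' Q' R' : Fin 2 → k}
    (hPQ : P 0 * Q 1 - P 1 * Q 0 ≠ 0) (hPR : P 0 * R 1 - P 1 * R 0 ≠ 0)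
    (hQR : Q 0 * R 1 - Q 1 * R 0 ≠ 0) (hPQ' : P' 0 * Q' 1 - P' 1 * Q' 0 ≠ 0)
    (hPR' : P' 0 * R' 1 - P' 1 * R' 0 ≠ 0) (hQR' : Q' 0 * R' 1 - Q' 1 * R' 0 ≠ 0)
    (g : Matrix (Fin 2) (Fin 2) K) {a b c : K}
    (hgP : g *ᵥ (⇑ι ∘ P) = a • (⇑ι ∘ P')) (hgQ : g *ᵥ (⇑ι ∘ Q) = b • (⇑ι ∘ Q'))
    (hgR : g *ᵥ (⇑ι ∘ R) = c • (⇑ι ∘ R')) (hg : g.det ≠ 0) (Y : Fin 2 → k) :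
    ∃ (e : K) (X : Fin 2 → k), e ≠ 0 ∧ g *ᵥ (⇑ι ∘ X) = e • (⇑ι ∘ Y) ∧ (Y ≠ 0 → X ≠ 0) := by
  obtain ⟨l, g₀, hl, hdet, rfl⟩ :=
    exists_eq_smul_map_of_three_points_of_det_ne_zero ι hPQ hPR hQR hPQ' hPR' hQR' g hgP hgQ hgR hg
  have hunit : IsUnit g₀.det := isUnit_iff_ne_zero.mpr hdet
  have hY : g₀ *ᵥ (g₀⁻¹ *ᵥ Y) = Y := by
    rw [mulVec_mulVec, mul_nonsing_inv g₀ hunit, one_mulVec]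
  refine ⟨l, g₀⁻¹ *ᵥ Y, hl, ?_, fun hY0 hX => hY0 ?_⟩
  · rw [smul_mulVec, map_mulVec_comp, hY]
  · rw [← hY, hX, mulVec_zero]

open scoped LinearAlgebra.Projectivization in
/-- **The same in Mathlib's `ℙ K (Fin 2 → K)` with the action of `GL (Fin 2) K`**: an element of
`GL(2, K)` that moves three pairwise distinct `k`-rational points of the projective line to
`k`-rational points moves every `k`-rational point to a `k`-rational point.
[cite: BambergPenttila2023, §4.2 Corollary 4.8 (von Staudt) — consequence over a subfield] -/
theorem smul_mk_rational_of_three_points (ι : k →+* K) {P Q R P' Q' R' : Fin 2 → k}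
    (hPQ : P 0 * Q 1 - P 1 * Q 0 ≠ 0) (hPR : P 0 * R 1 - P 1 * R 0 ≠ 0)
    (hQR : Q 0 * R 1 - Q 1 * R 0 ≠ 0) (hPQ' : P' 0 * Q' 1 - P' 1 * Q' 0 ≠ 0)
    (hPR' : P' 0 * R' 1 - P' 1 * R' 0 ≠ 0) (hQR' : Q' 0 * R' 1 - Q' 1 * R' 0 ≠ 0)
    (g : GL (Fin 2) K)
    {hP : ⇑ι ∘ P ≠ 0} {hQ : ⇑ι ∘ Q ≠ 0} {hR : ⇑ι ∘ R ≠ 0}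
    {hP' : ⇑ι ∘ P' ≠ 0} {hQ' : ⇑ι ∘ Q' ≠ 0} {hR' : ⇑ι ∘ R' ≠ 0}
    (hgP : g • Projectivization.mk K (⇑ι ∘ P) hP = Projectivization.mk K (⇑ι ∘ P') hP')
    (hgQ : g • Projectivization.mk K (⇑ι ∘ Q) hQ = Projectivization.mk K (⇑ι ∘ Q') hQ')
    (hgR : g • Projectivization.mk K (⇑ι ∘ R) hR = Projectivization.mk K (⇑ι ∘ R') hR')
    {X : Fin 2 → k} (hX : ⇑ι ∘ X ≠ 0) :
    ∃ (Y : Fin 2 → k) (hY : ⇑ι ∘ Y ≠ 0),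
      g • Projectivization.mk K (⇑ι ∘ X) hX = Projectivization.mk K (⇑ι ∘ Y) hY := by
  rw [Projectivization.smul_mk, Projectivization.mk_eq_mk_iff'] at hgP hgQ hgR
  obtain ⟨a, ha⟩ := hgP
  obtain ⟨b, hb⟩ := hgQ
  obtain ⟨c, hc⟩ := hgR
  simp only [Units.smul_def, smul_eq_mulVec] at ha hb hc
  have hg : (g : Matrix (Fin 2) (Fin 2) K).det ≠ 0 :=
    ((isUnit_iff_isUnit_det _).mp g.isUnit).ne_zero
  obtain ⟨l, g₀, hl, hdet, hg₀⟩ := exists_eq_smul_map_of_three_points_of_det_ne_zero ι hPQ hPR hQR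
    hPQ' hPR' hQR' (g : Matrix (Fin 2) (Fin 2) K) ha.symm hb.symm hc.symm hg
  have hX0 : X ≠ 0 := by rintro rfl; exact hX (by funext i; simp)
  have hY0 : g₀ *ᵥ X ≠ 0 := fun h => hX0 (eq_zero_of_mulVec_eq_zero hdet h)
  refine ⟨g₀ *ᵥ X, comp_ne_zero ι hY0, ?_⟩
  rw [Projectivization.smul_mk, Projectivization.mk_eq_mk_iff']
  refine ⟨l, ?_⟩
  rw [Units.smul_def, smul_eq_mulVec, hg₀, smul_mulVec, map_mulVec_comp]

end ThreePoints

section Fibres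

/-! ## §2 Rational fibres of a rational function over an algebraically closed subfield -/

variable {k : Type u} {K : Type v} [Field k] [IsAlgClosed k] [Field K] [Algebra k K]

/-- **Roots are rational over an algebraically closed subfield**: if `k` is algebraically closed
and `K ⊇ k` is any field extension, every root `x ∈ K` of a non-zero polynomial `p` over `k` lies
in (the image of) `k` — `x` is algebraic over `k`, and its minimal polynomial, irreducible over the
algebraically closed field `k`, is linear.
[cite: StacksProject, Tag 09GR, (4) ⇒ (2) — consequence for roots in an extension field] -/
theorem mem_range_algebraMap_of_aeval_eq_zero {p : k[X]} (hp : p ≠ 0) {x : K}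
    (hx : aeval x p = 0) : x ∈ (algebraMap k K).range := by
  have halg : IsAlgebraic k x := ⟨p, hp, hx⟩
  have hint : IsIntegral k x := halg.isIntegral
  exact minpoly.mem_range_of_degree_eq_one k x
    (IsAlgClosed.degree_eq_one_of_irreducible k (minpoly.irreducible hint))

/-- **Fibres of a `k`-rational function over `k`-points are `k`-rational**: for polynomials `p, q`
over the algebraically closed field `k` with `p ≠ a·q` (i.e. `p/q` is not the constant `a`), every
solution `x ∈ K` of `p(x) = a·q(x)` lies in `k` — the fibre of `p/q : ℙ¹ → ℙ¹` over the point `a`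
(and, by `mem_range_algebraMap_of_aeval_eq_zero` for `q`, over `∞`) consists of `k`-points.
[cite: StacksProject, Tag 09GR, (4) ⇒ (2) — consequence for the fibres of a rational function] -/
theorem mem_range_algebraMap_of_aeval_eq_mul {p q : k[X]} {a : k} (hpq : p ≠ C a * q) {x : K}
    (hx : aeval x p = algebraMap k K a * aeval x q) : x ∈ (algebraMap k K).range := by
  refine mem_range_algebraMap_of_aeval_eq_zero (p := p - C a * q) (sub_ne_zero.mpr hpq) ?_
  rw [map_sub, map_mul, aeval_C, hx, sub_self]

end Fibres

end Literature.AlgebraicGeometry.ProjectiveSpace
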